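import Summits.SmoothPoincare4.SmoothPoincare4.Theorems.SblfDescentRungOneHelperFoldNFPageHessian
import Literature.Topology.FourManifolds.FibrewiseMorseFramePeriodic
import HarnessLib

/-!
# The periodic adapted frame along the round circle from a continuous choice of nappe

Helper `helper_foldNF_periodicFrame_of_timelike` of stub `helper_sliceGluing_foldNormalForm` (the
`S¹`-parametric fold normal form of the round circle), line `Sketch`, crux `SblfDescent.RungOne`.

(Crux item stmt-SmoothPoincare4-18531; skeleton `Cruxes/RungOne/Lines/Sketch.lean`.)

The residual hypothesis of the fold normal form (`helper_foldNF_periodicFrame`: a `C^∞`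
`1`-periodic frame adapted to the page Hessians `H_t` of the height along a tube about the round
circle) is reduced to its topological core, the UNTWISTEDNESS of the round `1`-handle in the
most elementary form `helper_foldNF_timelike`: **a continuous `1`-periodic field `w t` of
`H_t`-timelike vectors** (`H_t (w t, w t) < 0`: a continuous choice, around the circle, of one of
the two nappes of the cone of directions pointing into the sphere side).  Indeed the page
Hessians are nondegenerate of index one with pointwise frames (`helper_foldNF_pageHessian`), so
`H_0 = c · B` with `B (a, b) = (P a · P b)_{(+,+,-)}` presented by the Lorentz frame
`P⁻¹ e₂, P⁻¹ e₀, P⁻¹ e₁`, and the tree's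
`Splitting.exists_periodic_adaptedFrame_of_timelike` (interval frames closed up periodically
through O'Neill's timecone lemma and a path in `SO⁺(1, 2)`; Banyaga–Hurtubise 2004, Thm. 2)
yields a periodic frame `Fr` with `H_t = c B (Fr t ·, Fr t ·)`; then `M t = √(c/2) · P ∘ Fr t`
is adapted to `2 (a₀b₀ + a₁b₁ - a₂b₂)`.

## References

* A. Banyaga, D. E. Hurtubise, *A proof of the Morse–Bott Lemma*, Expo. Math. 22 (2004),
  Thm. 2. [BanyagaHurtubise2004]
* B. O'Neill, *Semi-Riemannian Geometry* (1983), Ch. 5, Lemma 29; Ch. 9, Lemma 6. [ONeill1983]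
* R. İ. Baykur, S. Kamada, *Classification of broken Lefschetz fibrations with small fiber
  genera*, J. Math. Soc. Japan 67 (2015), §2, §5. [BaykurKamada2015]
-/

set_option linter.dupNamespace false

noncomputable section

open scoped Manifold ContDiff Topology RealInnerProductSpace
open Set Function Filter Metric Literature.Topology.FourManifolds
  Literature.AlgebraicTopology.SingularHomology

namespace Summit.SmoothPoincare4.SmoothPoincare4.Cruxes.RungOne.Sketch

/-- Local notation: `𝔼 n` is the model Euclidean space `EuclideanSpace ℝ (Fin n)`. -/
local notation "𝔼 " n:arg => EuclideanSpace ℝ (Fin n)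

/-- Local notation: `𝕊²`, the unit sphere of `ℝ³`. -/
local notation "𝕊²" => (Metric.sphere (0 : EuclideanSpace ℝ (Fin 3)) (1 : ℝ))

attribute [local instance] Literature.Topology.FourManifolds.fact_finrank_euclideanSpace_succ

/-- **A Lorentz frame for the pull-back of the standard index-one form.**  For an invertible
`P : ℝ³ ≃L ℝ³`, the form `B (a, b) = (P a)₀(P b)₀ + (P a)₁(P b)₁ - (P a)₂(P b)₂` is presented
by the Lorentz frame `v₀ = P⁻¹ e₂`, `b₁ = P⁻¹ e₀`, `b₂ = P⁻¹ e₁` (signs `(-, +, +)`,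
`B`-orthonormal, with the coordinate expansion). [folklore] -/
theorem lorentzFrame_of_equiv (P : 𝔼 3 ≃L[ℝ] 𝔼 3) {B : 𝔼 3 →L[ℝ] 𝔼 3 →L[ℝ] ℝ}
    (hB : ∀ a b : 𝔼 3, B a b = (P a) 0 * (P b) 0 + (P a) 1 * (P b) 1 - (P a) 2 * (P b) 2) :
    B (P.symm (EuclideanSpace.single 2 1)) (P.symm (EuclideanSpace.single 2 1)) = -1 ∧
    B (P.symm (EuclideanSpace.single 0 1)) (P.symm (EuclideanSpace.single 0 1)) = 1 ∧
    B (P.symm (EuclideanSpace.single 1 1)) (P.symm (EuclideanSpace.single 1 1)) = 1 ∧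
    B (P.symm (EuclideanSpace.single 2 1)) (P.symm (EuclideanSpace.single 0 1)) = 0 ∧
    B (P.symm (EuclideanSpace.single 2 1)) (P.symm (EuclideanSpace.single 1 1)) = 0 ∧
    B (P.symm (EuclideanSpace.single 0 1)) (P.symm (EuclideanSpace.single 1 1)) = 0 ∧
    ∀ x : 𝔼 3, x = (-B (P.symm (EuclideanSpace.single 2 1)) x) • P.symm (EuclideanSpace.single 2 1) +
      B (P.symm (EuclideanSpace.single 0 1)) x • P.symm (EuclideanSpace.single 0 1) +
      B (P.symm (EuclideanSpace.single 1 1)) x • P.symm (EuclideanSpace.single 1 1) := by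
  simp only [hB, ContinuousLinearEquiv.apply_symm_apply]
  refine ⟨by simp, by simp, by simp, by simp, by simp, by simp, fun x => ?_⟩
  apply P.injective
  simp only [map_add, map_smul, ContinuousLinearEquiv.apply_symm_apply]
  ext i
  fin_cases i <;> simp

/-- **The periodic adapted frame from a continuous periodic timelike field** (the untwistedness
of the round handle in its elementary form).  For a genus-one Lefschetz-free SBLF with equatorial
round image and torus-side pole `v`: if along every tube `ν₀` about the round circle there is a
continuous `1`-periodic field `w` of `H_t`-timelike vectors for the page Hessians `H_t` of the
height, then the page Hessians admit a `C^∞` `1`-periodic frame adapted to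
`2 (a₀b₀ + a₁b₁ - a₂b₂)` (`helper_foldNF_pageHessian` + the tree's
`Splitting.exists_periodic_adaptedFrame_of_timelike`). [cite: BanyagaHurtubise2004, Thm. 2]
[cite: ONeill1983, Ch. 9, Lemma 6] -/
theorem helper_foldNF_periodicFrame_of_timelike : (∀ (X : Type) [TopologicalSpace X] [T2Space X] [SecondCountableTopology X] [CompactSpace X] [ChartedSpace (𝔼 4) X] [IsManifold (𝓡 4) ∞ X] (o : SmoothOrientation (𝓡 4) X) (f : X → 𝕊²), IsSimplifiedBrokenLefschetzFibration o f ∅ 0 → f '' ({p : X | ¬ Surjective (mfderiv (𝓡 4) (𝓡 2) f p)} \ (↑(∅ : Finset X) : Set X)) = sphereEquator 1 → ∀ (v : 𝕊²), (v : 𝔼 3) 0 = 0 → (v : 𝔼 3) 1 = 0 → (∀ y : 𝕊², ⟪(y : 𝔼 3), (v : 𝔼 3)⟫ < 0 → (∀ q, f q = y → Surjective (mfderiv (𝓡 4) (𝓡 2) f q)) ∧ Nonempty ((Fin (2 * 0) → ℤ) ≃ₗ[ℤ] singularHomology ℤ ℤ ↥(f ⁻¹' {y}) 1)) → (∀ y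 : 𝕊², ⟪(y : 𝔼 3), ((-v : 𝕊²) : 𝔼 3)⟫ < 0 → (∀ q, f q = y → Surjective (mfderiv (𝓡 4) (𝓡 2) f q)) ∧ Nonempty ((Fin (2 * (0 + 1)) → ℤ) ≃ₗ[ℤ] singularHomology ℤ ℤ ↥(f ⁻¹' {y}) 1)) → ∀ (e : Metric.sphere (0 : 𝔼 2) 1 → X) (ν₀ : CircleNbhd (𝓡 4) e), Set.range e = {p : X | ¬ Surjective (mfderiv (𝓡 4) (𝓡 2) f p)} \ (↑(∅ : Finset X) : Set X) → (∀ u, f (e u) = sphereInclusion 1 2 one_le_two u) → ∃ w : ℝ → 𝔼 3, Continuous w ∧ (∀ t : ℝ, w (t + 1) = w t) ∧ ∀ t : ℝ, fderiv ℝ (fderiv ℝ (fun q : ℝ × 𝔼 3 => SphereHeight.height (v : 𝔼 3) (f (ν₀.toFun (circlePt q.1, q.2))))) (t, 0) ((0 : ℝ), w t) ((0 : ℝ), w t) < 0) → ∀ (X : Type) [TopologicalSpace X] [T2Space X] [SecondCountableTopology X] [CompactSpace X] [ChartedSpace (𝔼 4) X] [IsManifold (𝓡 4) ∞ X] (o :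 SmoothOrientation (𝓡 4) X) (f : X → 𝕊²), IsSimplifiedBrokenLefschetzFibration o f ∅ 0 → f '' ({p : X | ¬ Surjective (mfderiv (𝓡 4) (𝓡 2) f p)} \ (↑(∅ : Finset X) : Set X)) = sphereEquator 1 → ∀ (v : 𝕊²), (v : 𝔼 3) 0 = 0 → (v : 𝔼 3) 1 = 0 → (∀ y : 𝕊², ⟪(y : 𝔼 3), (v : 𝔼 3)⟫ < 0 → (∀ q, f q = y → Surjective (mfderiv (𝓡 4) (𝓡 2) f q)) ∧ Nonempty ((Fin (2 * 0) → ℤ) ≃ₗ[ℤ] singularHomology ℤ ℤ ↥(f ⁻¹' {y}) 1)) → (∀ y : 𝕊², ⟪(y : 𝔼 3), ((-v : 𝕊²) : 𝔼 3)⟫ < 0 → (∀ q, f q = y → Surjective (mfderiv (𝓡 4) (𝓡 2) f q)) ∧ Nonempty ((Fin (2 * (0 + 1)) → ℤ) ≃ₗ[ℤ] singularHomology ℤ ℤ ↥(f ⁻¹' {y}) 1)) → ∀ (e : Metric.sphere (0 : 𝔼 2) 1 → X) (ν₀ : CircleNbhd (𝓡 4) e), Set.range e = {p : X | ¬ Surjective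 (mfderiv (𝓡 4) (𝓡 2) f p)} \ (↑(∅ : Finset X) : Set X) → (∀ u, f (e u) = sphereInclusion 1 2 one_le_two u) → ∃ (M Minv : ℝ → (𝔼 3 →L[ℝ] 𝔼 3)), ContDiff ℝ ∞ M ∧ ContDiff ℝ ∞ Minv ∧ (∀ t : ℝ, M (t + 1) = M t) ∧ (∀ t : ℝ, Minv (t + 1) = Minv t) ∧ (∀ (t : ℝ) (a : 𝔼 3), M t (Minv t a) = a) ∧ (∀ (t : ℝ) (a : 𝔼 3), Minv t (M t a) = a) ∧ (∀ (t : ℝ) (a b : 𝔼 3), fderiv ℝ (fderiv ℝ (fun q : ℝ × 𝔼 3 => SphereHeight.height (v : 𝔼 3) (f (ν₀.toFun (circlePt q.1, q.2))))) (t, 0) ((0 : ℝ), a) ((0 : ℝ), b) = 2 * ((M t a) 0 * (M t b) 0 + (M t a) 1 * (M t b) 1 - (M t a) 2 * (M t b) 2)) := by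
  intro htl X _ _ _ _ _ _ o f hf hround v hv0 hv1 hlo hhi e ν₀ hrange hfe
  obtain ⟨w, hw, hwT, hwneg⟩ := htl X o f hf hround v hv0 hv1 hlo hhi e ν₀ hrange hfe
  have hpage := helper_foldNF_pageHessian X o f hf hround v hv0 hv1 hlo hhi e ν₀ hrange hfe
  obtain ⟨-, -, -, hgs, -, -, -⟩ := helper_foldNF_family X o f hf hround v hv0 hv1 e ν₀ hrange hfe
  set g : ℝ × 𝔼 3 → ℝ := fun q => SphereHeight.height (v : 𝔼 3) (f (ν₀.toFun (circlePt q.1, q.2)))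
    with hgdef
  have hgT : ∀ (t : ℝ) (u : 𝔼 3), g (t + 1, u) = g (t, u) := fun t u => by
    simp [hgdef, circlePt_add_one]
  have hnd : ∀ (t : ℝ) (a : 𝔼 3),
      (∀ b, fderiv ℝ (fderiv ℝ g) (t, 0) ((0 : ℝ), a) ((0 : ℝ), b) = 0) → a = 0 :=
    fun t => (hpage t).1
  -- the reference form at `t = 0`: `H_0 = (2c) · B`, `B (a, b) = Q (P a, P b)`
  obtain ⟨c, P, hc, hPinj, hH0⟩ := (hpage 0).2
  set Pe : 𝔼 3 ≃L[ℝ] 𝔼 3 := (LinearEquiv.ofInjectiveEndo P.toLinearMap hPinj).toContinuousLinearEquiv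
    with hPe
  have hPe' : ∀ a, Pe a = P a := fun a => rfl
  obtain ⟨Bq, hBq⟩ := exists_clm_sliceForm
  set B : 𝔼 3 →L[ℝ] 𝔼 3 →L[ℝ] ℝ := Bq.bilinearComp (Pe : 𝔼 3 →L[ℝ] 𝔼 3) (Pe : 𝔼 3 →L[ℝ] 𝔼 3)
    with hBdef
  have hB : ∀ a b : 𝔼 3, B a b = (Pe a) 0 * (Pe b) 0 + (Pe a) 1 * (Pe b) 1 - (Pe a) 2 * (Pe b) 2 :=
    fun a b => by simp [hBdef, hBq]
  have hBsymm : ∀ a b, B a b = B b a := fun a b => by rw [hB, hB]; ring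
  have hHB : ∀ a b : 𝔼 3, fderiv ℝ (fderiv ℝ g) ((0 : ℝ), (0 : 𝔼 3)) ((0 : ℝ), a) ((0 : ℝ), b) =
      (2 * c) * B a b := fun a b => by
    rw [hB, hPe', hPe', hH0 a b]; ring
  obtain ⟨hv, h1, h2, h01, h02, h12, hexp⟩ := lorentzFrame_of_equiv Pe hB
  obtain ⟨Fr, Frinv, hFr, hFrinv, hFrT, hFrinvT, hri, hli, had⟩ :=
    Splitting.exists_periodic_adaptedFrame_of_timelike hgs one_pos hgT hnd hBsymm
      (by positivity : (0 : ℝ) < 2 * c) hHB hv h1 h2 h01 h02 h12 hexp hw hwT hwneg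
  -- rescale: `M t = √c · P ∘ Fr t`
  set r : ℝ := Real.sqrt c with hr
  have hr0 : r ≠ 0 := (Real.sqrt_pos.2 hc).ne'
  have hrr : r * r = c := Real.mul_self_sqrt hc.le
  refine ⟨fun t => r • ((Pe : 𝔼 3 →L[ℝ] 𝔼 3).comp (Fr t)),
    fun t => r⁻¹ • ((Frinv t).comp (Pe.symm : 𝔼 3 →L[ℝ] 𝔼 3)), ?_, ?_, fun t => by simp only [hFrT],
    fun t => by simp only [hFrinvT], fun t a => ?_, fun t a => ?_, fun t a b => ?_⟩
  · exact (contDiff_const.clm_comp hFr).const_smul _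
  · exact (hFrinv.clm_comp contDiff_const).const_smul _
  · simp only [smul_apply, ContinuousLinearMap.comp_apply, map_smul,
      ContinuousLinearEquiv.coe_coe, hri, ContinuousLinearEquiv.apply_symm_apply, smul_smul]
    rw [inv_mul_cancel₀ hr0, one_smul]
  · simp only [smul_apply, ContinuousLinearMap.comp_apply, map_smul,
      ContinuousLinearEquiv.coe_coe, ContinuousLinearEquiv.symm_apply_apply, hli, smul_smul]
    rw [mul_inv_cancel₀ hr0, one_smul]
  · rw [had t a b, hB]
    simp only [smul_apply, ContinuousLinearMap.comp_apply,
      ContinuousLinearEquiv.coe_coe, PiLp.smul_apply, smul_eq_mul]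
    rw [← hrr]
    ring

end Summit.SmoothPoincare4.SmoothPoincare4.Cruxes.RungOne.Sketch

end
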